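import Summits.QuantumFields.BalabanUV.Beta.GAN24.WoodburyFibreZeroModeGainUnits

/-!
# GAN24 / WoodburyFibreZeroModeGainTwoRate — the zero-mode gain ACROSS SCALES: a TWO-RATE composition lemma (fast kernel ∘ slow leg decays at the
# SLOW rate with the lattice constant at the rate GAP) and the two-rate forms of the gains, so that a level-`m` block `Γ_m^{ff}` (rate `δ_Γ = O(1)`)
# composed with a level-`n` leg (rate `δ_J ~ Lc^{−(n−m)}`, forward differences `ε ~ Lc^{−(n−m)}`) keeps BOTH the slow rate and an `O(1)·ε` constant
# (census row V14 of `HOME/b2b-balaban-gan24-p3/WOODBURY-FIBRE.md` v8; binder row G-an2-4 ∕ (CONV-C), P3, gen 8)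

Cell `pub-balaban`, β sub-cell.  HONEST FRAMING (verbatim): discharging `BetaPertH` makes Bałaban's UV stability UNCONDITIONAL — a real
constructive-QFT result; it is NOT the continuum limit and NOT the Clay problem.  HONEST DEPENDENCY (verbatim): continuum YM on T⁴ ⇐
BetaPertH ∧ nine spine estimates (0/9 proved); BetaPertH ⇐ (D1) ∧ (D4) ∧ CAP+tail; G-an2-4 gates asym, D1 and NE2/3/4.  NOT IN PRINT; OUR
BOOKKEEPING.  [folklore] over an2's `ExpKernelCalculus` (`exp_split`, `summable_exp_shift`, `tsum_exp_shift`) and the companion files BY NAME;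
cites nothing, mints no `def … : Prop`, instantiates no wall binder; every `Decays` ∕ forward-difference datum is a HYPOTHESIS.  Discharges NOTHING
of (CONV-C), the W-slot, «T2Shape», (D1); NEVER «G-an2-4 closed»; NOT BetaPertH, NOT continuum, NOT Clay.

## Why (context only; asserted nowhere below)
The single-rate packaging of `WoodburyFibreZeroModeGain` (an2's `decays_comp`: both factors at one rate `δ`, output `δ′ < δ`, constant
`Zl(δ − δ′)`) is LOSSY across scales: with `Γ_m^{ff}` at `δ_Γ = O(1)` and a level-`n` leg at `δ_J ≪ δ_Γ`, the common rate is `δ_J` and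
`Zl(δ_J − δ′) ≳ (δ_J − δ′)^{−D}` would eat the gain `ε ~ Lc^{−(n−m)}` `D` times over — exactly the «rate arithmetic» warned about in the W∕T₂
planning note (journal 2026-08-20 l.6956).  The two-rate lemma below splits `e^{−δ_Γ|x−y|}·e^{−δ_J|y−z|} ≤ e^{−(δ_Γ−δ′)|x−y|}·e^{−δ′|x−z|}` for
`δ′ ≤ δ_J`, `δ′ < δ_Γ`: output rate up to the SLOW rate `δ_J` itself, lattice constant `Zl(δ_Γ − δ′)` at the GAP — `O(1)` when `δ_J ≤ δ_Γ/2`.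

## Contents (all [folklore])
* §1 (any `D`, `F`) **`decays_comp_two_rate`**: `Decays A C_A δ_A`, `Decays B C_B δ_B`, `0 ≤ δ′ ≤ δ_B`, `δ′ < δ_A` ⇒ `Decays (comp A B) (|F|·(C_A·C_B)·Zl_D(δ_A − δ′)) δ′`;
  **`decays_comp_two_rate'`** (the mirror: slow ∘ fast, constant `Zl_D(δ_B − δ′)`).
* §2 two-rate gains: **`decays_comp_of_annihil_right₂`** (`Γ` at `δ_Γ`, `J − J₀` at `δ_J`: constant `|F|·C_Γ·ω·Zl(δ_Γ − δ′)`, rate `δ′ ≤ δ_J`, `δ′ < δ_Γ`),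
  **`decays_comp_of_annihil_left₂`**.
* §3 turn-key two-rate forms for `Γ := blockFF (unitK sf sm (KInvStep Lc j))` (and `sf = sm = 1`-free: any reals): **`decays_comp_ffUnitKInvStep_of_fwdDiff₂`**:
  `Decays Γ C_Γ δ_Γ` (`δ_Γ > 0`), `Decays J C_J δ_J`, forward differences of `J` `≤ ε·e^{−δ_J|y−z|₁}`, `0 ≤ δ′ ≤ δ_J`, `δ′ < δ_Γ` ⇒
  `Decays (Γ ∘ J) (|Fib d|·(C_Γ·ω(ε, δ_J))·Zl_{d+1}(δ_Γ − δ′)) δ′`, `ω(ε, δ_J) = (d+2)(Lc−1)·ε·e^{2δ_J(d+2)(Lc−1)}`; left twin.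
READING: `δ′ = δ_J ≤ δ_Γ/2` ⇒ constant `|Fib d|·C_Γ·(d+2)(Lc−1)·e^{2δ_J(d+2)(Lc−1)}·Zl(δ_Γ/2)·ε` at the leg's own rate — NO loss in the rate, `O(1)·ε` in the constant.
-/

noncomputable section

open Finset
open scoped BigOperators
open Literature.MathematicalPhysics.QuantumFieldTheory
open Literature.MathematicalPhysics.QuantumFieldTheory.Balaban1983to89
open Literature.MathematicalPhysics.QuantumFieldTheory.Balaban1983to89.Beta
open B12Sec2to5 (l1 l1_nonneg)
open ExpKernelCalculus (MKer Decays comp Zl exp_split summable_exp_shift tsum_exp_shift l1_sub_triangle)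
open KernelWard (Bdd bdd_of_decays comp_sub_right comp_sub_left)
open Summit.QuantumFields.BalabanUV.Beta.TameKernelCalculus (RowMaj ColMaj Spr)
open AffineAveraging (unitVec)
open OneStepResolventKernel (Fib)
open OneStepKernelFamily (KInvStep)
open Summit.QuantumFields.BalabanUV.Beta.HessKerDressedUnits (unitK)
open Summit.QuantumFields.BalabanUV.Beta.GAN24.WoodburyFibreBlocks (blockFF)
open Summit.QuantumFields.BalabanUV.Beta.GAN24.WoodburyFibreZeroModeGain
open Summit.QuantumFields.BalabanUV.Beta.GAN24.WoodburyFibreZeroModeGainKInv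
open Summit.QuantumFields.BalabanUV.Beta.GAN24.WoodburyFibreZeroModeOsc
open Summit.QuantumFields.BalabanUV.Beta.GAN24.WoodburyFibreZeroModeGainStep
open Summit.QuantumFields.BalabanUV.Beta.GAN24.WoodburyFibreZeroModeGainUnits

namespace Summit.QuantumFields.BalabanUV.Beta.GAN24.WoodburyFibreZeroModeGainTwoRate

/-! ## §1 Two-rate composition: fast ∘ slow decays at the slow rate, lattice constant at the gap -/

section TwoRate

variable {D : ℕ} {F : Type*} [Fintype F]

/-- Termwise two-rate bound: `|Σ_f A(x,y)_{af}B(y,z)_{fb}| ≤ |F|·C_A·C_B·e^{−δ′|x−z|₁}·e^{−(δ_A−δ′)|x−y|₁}` for `0 ≤ δ′ ≤ δ_B`. [folklore] -/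
theorem abs_compTerm_le_two_rate {A B : MKer D F} {CA CB δA δB δ' : ℝ} (hA : Decays A CA δA) (hB : Decays B CB δB) (h0 : 0 ≤ δ')
    (h1 : δ' ≤ δB) (x z : Fin D → ℤ) (a b : F) (y : Fin D → ℤ) :
    |∑ f, A x y a f * B y z f b| ≤
      (Fintype.card F : ℝ) * (CA * CB) * Real.exp (-δ' * l1 (x - z)) * Real.exp (-(δA - δ') * l1 (x - y)) := by
  classical
  have hCC : 0 ≤ CA * CB := mul_nonneg (hA.nonneg a) (hB.nonneg a)
  have hC : ∀ f, |A x y a f * B y z f b| ≤ (CA * CB) * Real.exp (-δ' * l1 (x - z)) * Real.exp (-(δA - δ') * l1 (x - y)) := by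
    intro f
    rw [abs_mul]
    have h3 := hA x y a f
    have h4 := hB y z f b
    have h5 : Real.exp (-δB * l1 (y - z)) ≤ Real.exp (-δ' * l1 (y - z)) := Real.exp_le_exp.mpr (by nlinarith [l1_nonneg (y - z)])
    calc |A x y a f| * |B y z f b| ≤ (CA * Real.exp (-δA * l1 (x - y))) * (CB * Real.exp (-δB * l1 (y - z))) :=
          mul_le_mul h3 h4 (abs_nonneg _) ((abs_nonneg _).trans h3)
      _ ≤ (CA * Real.exp (-δA * l1 (x - y))) * (CB * Real.exp (-δ' * l1 (y - z))) :=
          mul_le_mul_of_nonneg_left (mul_le_mul_of_nonneg_left h5 (hB.nonneg a)) (mul_nonneg (hA.nonneg a) (Real.exp_pos _).le)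
      _ = (CA * CB) * (Real.exp (-δA * l1 (x - y)) * Real.exp (-δ' * l1 (y - z))) := by ring
      _ ≤ (CA * CB) * (Real.exp (-(δA - δ') * l1 (x - y)) * Real.exp (-δ' * l1 (x - z))) := by
          refine mul_le_mul_of_nonneg_left ?_ hCC
          rw [← Real.exp_add, ← Real.exp_add, Real.exp_le_exp]
          have ht := l1_sub_triangle x y z
          nlinarith [l1_nonneg (x - y), l1_nonneg (y - z), l1_nonneg (x - z)]
      _ = (CA * CB) * Real.exp (-δ' * l1 (x - z)) * Real.exp (-(δA - δ') * l1 (x - y)) := by ring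
  calc |∑ f, A x y a f * B y z f b| ≤ ∑ f, |A x y a f * B y z f b| := Finset.abs_sum_le_sum_abs _ _
    _ ≤ ∑ _f : F, (CA * CB) * Real.exp (-δ' * l1 (x - z)) * Real.exp (-(δA - δ') * l1 (x - y)) := Finset.sum_le_sum fun f _ => hC f
    _ = _ := by rw [Finset.sum_const, Finset.card_univ, nsmul_eq_mul]; ring

/-- **TWO-RATE COMPOSITION (fast ∘ slow)**: `Decays A C_A δ_A`, `Decays B C_B δ_B`, `0 ≤ δ′ ≤ δ_B`, `δ′ < δ_A` ⇒
`Decays (comp A B) (|F|·(C_A·C_B)·Zl_D(δ_A − δ′)) δ′` — output rate up to the slow rate `δ_B`, lattice constant at the gap `δ_A − δ′`. [folklore] -/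
theorem decays_comp_two_rate {A B : MKer D F} {CA CB δA δB δ' : ℝ} (hA : Decays A CA δA) (hB : Decays B CB δB) (h0 : 0 ≤ δ')
    (h1 : δ' ≤ δB) (h2 : δ' < δA) : Decays (comp A B) ((Fintype.card F : ℝ) * (CA * CB) * Zl D (δA - δ')) δ' := by
  intro x z a b
  unfold ExpKernelCalculus.comp
  have hs := summable_exp_shift (show 0 < δA - δ' by linarith) x
  have hmaj := hs.mul_left ((Fintype.card F : ℝ) * (CA * CB) * Real.exp (-δ' * l1 (x - z)))
  have hb := tsum_of_norm_bounded hmaj.hasSum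
    (fun y => by rw [Real.norm_eq_abs]; exact abs_compTerm_le_two_rate hA hB h0 h1 x z a b y)
  rw [Real.norm_eq_abs] at hb
  refine hb.trans (le_of_eq ?_)
  rw [tsum_mul_left, tsum_exp_shift]
  ring

/-- Termwise two-rate bound, mirror (slow ∘ fast): weight `e^{−(δ_B−δ′)|y−z|₁}`, for `0 ≤ δ′ ≤ δ_A`. [folklore] -/
theorem abs_compTerm_le_two_rate' {A B : MKer D F} {CA CB δA δB δ' : ℝ} (hA : Decays A CA δA) (hB : Decays B CB δB) (h0 : 0 ≤ δ')
    (h1 : δ' ≤ δA) (x z : Fin D → ℤ) (a b : F) (y : Fin D → ℤ) :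
    |∑ f, A x y a f * B y z f b| ≤
      (Fintype.card F : ℝ) * (CA * CB) * Real.exp (-δ' * l1 (x - z)) * Real.exp (-(δB - δ') * l1 (z - y)) := by
  classical
  have hCC : 0 ≤ CA * CB := mul_nonneg (hA.nonneg a) (hB.nonneg a)
  have hC : ∀ f, |A x y a f * B y z f b| ≤ (CA * CB) * Real.exp (-δ' * l1 (x - z)) * Real.exp (-(δB - δ') * l1 (z - y)) := by
    intro f
    rw [abs_mul]
    have h3 := hA x y a f
    have h4 := hB y z f b
    have h5 : Real.exp (-δA * l1 (x - y)) ≤ Real.exp (-δ' * l1 (x - y)) := Real.exp_le_exp.mpr (by nlinarith [l1_nonneg (x - y)])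
    calc |A x y a f| * |B y z f b| ≤ (CA * Real.exp (-δA * l1 (x - y))) * (CB * Real.exp (-δB * l1 (y - z))) :=
          mul_le_mul h3 h4 (abs_nonneg _) ((abs_nonneg _).trans h3)
      _ ≤ (CA * Real.exp (-δ' * l1 (x - y))) * (CB * Real.exp (-δB * l1 (y - z))) :=
          mul_le_mul_of_nonneg_right (mul_le_mul_of_nonneg_left h5 (hA.nonneg a)) (mul_nonneg (hB.nonneg a) (Real.exp_pos _).le)
      _ = (CA * CB) * (Real.exp (-δ' * l1 (x - y)) * Real.exp (-δB * l1 (y - z))) := by ring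
      _ ≤ (CA * CB) * (Real.exp (-(δB - δ') * l1 (z - y)) * Real.exp (-δ' * l1 (x - z))) := by
          refine mul_le_mul_of_nonneg_left ?_ hCC
          rw [← Real.exp_add, ← Real.exp_add, Real.exp_le_exp]
          have ht := l1_sub_triangle x y z
          rw [ExpKernelCalculus.l1_sub_symm z y]
          nlinarith [l1_nonneg (x - y), l1_nonneg (y - z), l1_nonneg (x - z)]
      _ = (CA * CB) * Real.exp (-δ' * l1 (x - z)) * Real.exp (-(δB - δ') * l1 (z - y)) := by ring
  calc |∑ f, A x y a f * B y z f b| ≤ ∑ f, |A x y a f * B y z f b| := Finset.abs_sum_le_sum_abs _ _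
    _ ≤ ∑ _f : F, (CA * CB) * Real.exp (-δ' * l1 (x - z)) * Real.exp (-(δB - δ') * l1 (z - y)) := Finset.sum_le_sum fun f _ => hC f
    _ = _ := by rw [Finset.sum_const, Finset.card_univ, nsmul_eq_mul]; ring

/-- **TWO-RATE COMPOSITION (slow ∘ fast)**: `0 ≤ δ′ ≤ δ_A`, `δ′ < δ_B` ⇒ `Decays (comp A B) (|F|·(C_A·C_B)·Zl_D(δ_B − δ′)) δ′`. [folklore] -/
theorem decays_comp_two_rate' {A B : MKer D F} {CA CB δA δB δ' : ℝ} (hA : Decays A CA δA) (hB : Decays B CB δB) (h0 : 0 ≤ δ')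
    (h1 : δ' ≤ δA) (h2 : δ' < δB) : Decays (comp A B) ((Fintype.card F : ℝ) * (CA * CB) * Zl D (δB - δ')) δ' := by
  intro x z a b
  unfold ExpKernelCalculus.comp
  have hs := summable_exp_shift (show 0 < δB - δ' by linarith) z
  have hmaj := hs.mul_left ((Fintype.card F : ℝ) * (CA * CB) * Real.exp (-δ' * l1 (x - z)))
  have hb := tsum_of_norm_bounded hmaj.hasSum
    (fun y => by rw [Real.norm_eq_abs]; exact abs_compTerm_le_two_rate' hA hB h0 h1 x z a b y)
  rw [Real.norm_eq_abs] at hb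
  refine hb.trans (le_of_eq ?_)
  rw [tsum_mul_left, tsum_exp_shift]
  ring

/-! ## §2 Two-rate zero-mode gains -/

/-- **ZERO-MODE GAIN, RIGHT LEG, TWO RATES**: `Γ` at the fast rate `δ_Γ`, the oscillation `J − J₀` at the slow rate `δ_J`;
output rate `δ′ ≤ δ_J`, `δ′ < δ_Γ`, constant `|F|·(C_Γ·ω)·Zl_D(δ_Γ − δ′)`. [folklore] -/
theorem decays_comp_of_annihil_right₂ {Γ J J₀ : MKer D F} {CΓ ω δΓ δJ δ' BJ B₀ : ℝ} (hΓr : RowMaj Γ) (hJ : Bdd J BJ) (hJ₀ : Bdd J₀ B₀)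
    (h0 : comp Γ J₀ = 0) (hΓ : Decays Γ CΓ δΓ) (hω : Decays (J - J₀) ω δJ) (hδ'0 : 0 ≤ δ') (hδ'J : δ' ≤ δJ) (hδ'Γ : δ' < δΓ) :
    Decays (comp Γ J) ((Fintype.card F : ℝ) * (CΓ * ω) * Zl D (δΓ - δ')) δ' := by
  have hsplit : comp Γ J = comp Γ (J - J₀) := by
    rw [comp_sub_right (summable_slice_of_rowMaj_bdd hΓr hJ) (summable_slice_of_rowMaj_bdd hΓr hJ₀), h0, sub_zero]
  rw [hsplit]
  exact decays_comp_two_rate hΓ hω hδ'0 hδ'J hδ'Γ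

/-- **ZERO-MODE GAIN, LEFT LEG, TWO RATES**: `A − A₀` at the slow rate `δ_A`, `Γ` at the fast rate `δ_Γ`; constant `|F|·(ω·C_Γ)·Zl_D(δ_Γ − δ′)`. [folklore] -/
theorem decays_comp_of_annihil_left₂ {A A₀ Γ : MKer D F} {CΓ ω δΓ δA δ' BA B₀ : ℝ} (hA : Bdd A BA) (hA₀ : Bdd A₀ B₀) (hΓc : ColMaj Γ)
    (h0 : comp A₀ Γ = 0) (hω : Decays (A - A₀) ω δA) (hΓ : Decays Γ CΓ δΓ) (hδ'0 : 0 ≤ δ') (hδ'A : δ' ≤ δA) (hδ'Γ : δ' < δΓ) :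
    Decays (comp A Γ) ((Fintype.card F : ℝ) * (ω * CΓ) * Zl D (δΓ - δ')) δ' := by
  have hsplit : comp A Γ = comp (A - A₀) Γ := by
    rw [comp_sub_left (summable_slice_of_bdd_colMaj hA hΓc) (summable_slice_of_bdd_colMaj hA₀ hΓc), h0, sub_zero]
  rw [hsplit]
  exact decays_comp_two_rate' hω hΓ hδ'0 hδ'A hδ'Γ

end TwoRate

/-! ## §3 Turn-key two-rate forms for the W-slot's block `blockFF (unitK sf sm (KInvStep Lc j))` -/

section Step

variable {d : ℕ} {Lc : ℕ} [NeZero Lc]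

/-- **TURN-KEY, TWO RATES (right leg)**: `Γ := blockFF (unitK sf sm (KInvStep Lc j))` with `Decays Γ C_Γ δ_Γ` (`δ_Γ > 0`), a right leg `J` with
`Decays J C_J δ_J` and forward differences `≤ ε·e^{−δ_J|y−z|₁}` (`δ_J ≥ 0`): for `0 ≤ δ′ ≤ δ_J`, `δ′ < δ_Γ`,
`Decays (Γ ∘ J) (|Fib d|·(C_Γ·ω)·Zl_{d+1}(δ_Γ − δ′)) δ′`, `ω = (d+2)(Lc−1)·ε·e^{2δ_J(d+2)(Lc−1)}`. [folklore] -/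
theorem decays_comp_ffUnitKInvStep_of_fwdDiff₂ (sf sm : ℝ) (j : ℕ) {J : MKer (d + 1) (Fib d)} {CΓ CJ ε δΓ δJ δ' : ℝ}
    (hΓ : Decays (blockFF (unitK sf sm (KInvStep (d := d) Lc j))) CΓ δΓ) (hδΓ : 0 < δΓ) (hJ : Decays J CJ δJ) (hδJ : 0 ≤ δJ) (hε : 0 ≤ ε)
    (hD : ∀ μ y z f b, |J (y + unitVec μ) z f b - J y z f b| ≤ ε * Real.exp (-δJ * l1 (y - z)))
    (hδ'0 : 0 ≤ δ') (hδ'J : δ' ≤ δJ) (hδ'Γ : δ' < δΓ) :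
    Decays (comp (blockFF (unitK sf sm (KInvStep (d := d) Lc j))) J)
      ((Fintype.card (Fib d) : ℝ) *
        (CΓ * ((((d : ℝ) + 2) * ((Lc : ℝ) - 1)) * ε * Real.exp (2 * δJ * (((d : ℝ) + 2) * ((Lc : ℝ) - 1))))) *
          Zl (d + 1) (δΓ - δ')) δ' := by
  have hΓs : Spr (blockFF (unitK sf sm (KInvStep (d := d) Lc j))) := ⟨CΓ, δΓ, hδΓ, hΓ⟩
  have hJb : Bdd J CJ := bdd_of_decays hJ hδJ
  exact decays_comp_of_annihil_right₂ hΓs.tame.1 hJb (bdd_contourRef hJb)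
    (comp_contourRef_eq_zero hΓs.tame.1 hJb (fun x y a κ => blockFF_inr_right _ x y a κ)
      (fun x a κ u => contourSum_blockFF_unitKInvStep_right sf sm j x a κ u))
    hΓ (decays_sub_contourRef (N := Lc) hε hδJ hD) hδ'0 hδ'J hδ'Γ

/-- **TURN-KEY, TWO RATES (left leg)**: forward differences in the second variable of the left leg `A` at its own rate `δ_A`. [folklore] -/
theorem decays_comp_ffUnitKInvStep_of_fwdDiff_left₂ (sf sm : ℝ) (j : ℕ) {A : MKer (d + 1) (Fib d)} {CΓ CA ε δΓ δA δ' : ℝ}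
    (hA : Decays A CA δA) (hδA : 0 ≤ δA) (hΓ : Decays (blockFF (unitK sf sm (KInvStep (d := d) Lc j))) CΓ δΓ) (hδΓ : 0 < δΓ) (hε : 0 ≤ ε)
    (hD : ∀ μ x y a f, |A x (y + unitVec μ) a f - A x y a f| ≤ ε * Real.exp (-δA * l1 (x - y)))
    (hδ'0 : 0 ≤ δ') (hδ'A : δ' ≤ δA) (hδ'Γ : δ' < δΓ) :
    Decays (comp A (blockFF (unitK sf sm (KInvStep (d := d) Lc j))))
      ((Fintype.card (Fib d) : ℝ) *
        (((((d : ℝ) + 2) * ((Lc : ℝ) - 1)) * ε * Real.exp (2 * δA * (((d : ℝ) + 2) * ((Lc : ℝ) - 1)))) * CΓ) *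
          Zl (d + 1) (δΓ - δ')) δ' := by
  have hΓs : Spr (blockFF (unitK sf sm (KInvStep (d := d) Lc j))) := ⟨CΓ, δΓ, hδΓ, hΓ⟩
  have hAb : Bdd A CA := bdd_of_decays hA hδA
  exact decays_comp_of_annihil_left₂ hAb (bdd_contourRefL hAb) hΓs.tame.2.1
    (comp_contourRefL_eq_zero hAb hΓs.tame.2.1 (fun y z κ b => blockFF_inr_left _ y z κ b)
      (fun z b κ u => contourSum_blockFF_unitKInvStep_left sf sm j z b κ u))
    (decays_sub_contourRefL (N := Lc) hε hδA hD) hΓ hδ'0 hδ'A hδ'Γ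

/-- The same two, for the raw decimated block `blockFF (KInvStep Lc j)` (right leg). [folklore] -/
theorem decays_comp_ffKInvStep_of_fwdDiff₂ (j : ℕ) {J : MKer (d + 1) (Fib d)} {CΓ CJ ε δΓ δJ δ' : ℝ}
    (hΓ : Decays (blockFF (KInvStep (d := d) Lc j)) CΓ δΓ) (hδΓ : 0 < δΓ) (hJ : Decays J CJ δJ) (hδJ : 0 ≤ δJ) (hε : 0 ≤ ε)
    (hD : ∀ μ y z f b, |J (y + unitVec μ) z f b - J y z f b| ≤ ε * Real.exp (-δJ * l1 (y - z)))
    (hδ'0 : 0 ≤ δ') (hδ'J : δ' ≤ δJ) (hδ'Γ : δ' < δΓ) :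
    Decays (comp (blockFF (KInvStep (d := d) Lc j)) J)
      ((Fintype.card (Fib d) : ℝ) *
        (CΓ * ((((d : ℝ) + 2) * ((Lc : ℝ) - 1)) * ε * Real.exp (2 * δJ * (((d : ℝ) + 2) * ((Lc : ℝ) - 1))))) *
          Zl (d + 1) (δΓ - δ')) δ' := by
  have hΓs : Spr (blockFF (KInvStep (d := d) Lc j)) := ⟨CΓ, δΓ, hδΓ, hΓ⟩
  have hJb : Bdd J CJ := bdd_of_decays hJ hδJ
  exact decays_comp_of_annihil_right₂ hΓs.tame.1 hJb (bdd_contourRef hJb)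
    (comp_contourRef_eq_zero hΓs.tame.1 hJb (fun x y a κ => blockFF_inr_right _ x y a κ)
      (fun x a κ u => contourSum_blockFF_KInvStep_right j x a κ u))
    hΓ (decays_sub_contourRef (N := Lc) hε hδJ hD) hδ'0 hδ'J hδ'Γ

end Step

end Summit.QuantumFields.BalabanUV.Beta.GAN24.WoodburyFibreZeroModeGainTwoRate

end
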